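import Summits.HodgeConjecture.HodgeConjecture.Theorems.K2E1bDSCellDataLaws               -- ★ p856587 (U8-3 LAWS) over ★ p856546 (U8-3 DATA): `dsCellDatum`, `mem_dsCellDatum_S_iff`, vertices, `_square`, `_reach`
import Literature.RepresentationTheory.Kovacevic2021.SU21UnitarityFromProducts            -- ★ `isUnitarizable_iff_products_neg` (Kovačević Thm 4, datum form)
import HarnessLib

/-!
# K2 ∕ E1b unit U8, row U8-4 — FIRST BRICK `K2E1bDSCellUnitarizable`: the Kovačević cell data `dsCellDatum j a b c` of the discrete-series packet
# `Π(φ(a,b,c)) = {D_φ, D_φ⁺, D_φ⁻}` of `U(2,1)` are UNITARIZABLE (Kovačević's Theorem 4 on the three product cells)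

HCML Track B «K2-LIT», cell `hodgecm-mathlib`, crux H413 = stmt-HodgeConjecture-24833 (supports-only helper; closes nothing by itself).  Row U8-4
`K2E1bDSCellUnitary` of the TABLE `Lines/K2_E1b_GKCohomologyU21_U8_ArchPacketSigns.md` (ED. 7) reads «`dsCellDatum_cohUnitary` (★ #8∕#9 twist + ★
`SU21UnitarityCriterion`∕`UnitarityFromProducts` on product cells); then `dsClsOfRecord`, `LawDistinct`, `LawChi`, `LawGlob`».  THIS FILE is its first,
ruling-independent brick (default take K2E4-p10 (g2) 2026-09-04T01:55Z, E1b dealer K2E1b-plan (g3)): the `IsUnitarizable` hypothesis of ★ #10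
`K2E1bDatumCohUnitaryIrrep.DatumCohUnitaryIrrep` for the three cells — the other three hypotheses of #10 are ★ U8-3 (`dsCellDatum_isIrreducible`,
`dsCellDatum_casimir` with ★ `K2E1bDsDatum.sum_lie_lie_eq_casimir`, `dsCellDatum_integral`).

THE MATHEMATICS [Kovacevic2021 §4 Thm 4 «`V` is unitary iff (c30) `a_{nm} d_{n+1,m+3} < 0` and (c35) `b_{nm} c_{n+1,m−3} < 0`»; BorelWallach2000 VI Thm 4.12].
★ `isUnitarizable_iff_products_neg` (a strongly connected datum with a vertex and square-complete `K`-type set is unitarizable iff along every EDGE of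
`K`-types the invariant products `A D′`, `B C′` are negative reals) is fed with ★ U8-3: `hconn := dsCellDatum_reach`, the vertex `x₀` := the Blattner
vertex `(a−c+1, a+c−2b)` of `D_φ` (a local minimum, `dsCellDatum_vertex_zero`) resp. the CONE vertices `(1, 2t^±)` of `D_φ^±` (`dsCellDatum_coneVertex_one∕two`),
`hsq := dsCellDatum_square`.  On an edge inside a cell the subquotient products ARE those of the ambient principal series (★ `subquotient_AD∕BC`), i.e.
positive real multiples of Kovačević's `a(p)` ∕ `b(q)` (★ `principalSeries_AD∕BC`, (b75)∕(b80); the sign transfer `ps_AD_neg∕ps_BC_neg` below is the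
`⇐` half of ★ `SU21UnitarityPrincipalSeries.principalSeries_AD_sign∕BC_sign`, re-derived over ★ `SU21PrincipalSeriesData` to keep the import light), and the ★ LEVEL-B factorisations
(`acoef_plus`, `bcoef_plus`, `acoef_minus`, `bcoef_minus`) give the signs: `a⁺(p) = −(p+a−b+1)(p+a−c+1) < 0` and `b⁻(q) = −(q+b−c+1)(q+a−c+1) < 0` on the whole
cone; `b⁺(q) = −(q−(a−b−1))(q−(a−c−1)) < 0` for `q < a−b−1` (the `B`-edges of `D_φ⁺`) and for `q ≥ a−c` (those of `D_φ`); `a⁻(p) = −(p−(b−c−1))(p−(a−c−1)) < 0`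
for `p < b−c−1` (the `A`-edges of `D_φ⁻`).  (On the middle strips `J_φ^±` an internal edge has `b⁺ > 0` resp. `a⁻ > 0`: NOT unitarizable when the strip has
width `≥ 2` — row U8-5, not typed here.)

THEOREMS ONLY: sign lemmas §1 (+ the light sign-transfer `ps_AD_neg`∕`ps_BC_neg`), `dsCellD_isUnitarizable`, `dsCellDplus_isUnitarizable`, `dsCellDminus_isUnitarizable`, **`dsCellDatum_isUnitarizable`**.
No definition, no `sorry`, no named `Prop` fact, no instance (one `attribute [local instance] LieRing.ofAssociativeRing`, the Mathlib idiom of every ★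
Kovačević file), no notation.  HONEST LABEL: HC_CM is proved only modulo the 7 printed citations (2 remaining named inputs: hLiu418 = stmt-HodgeConjecture-24832,
h413 = stmt-HodgeConjecture-24833) until rung 0 closes; unitarizability of the carriers closes nothing by itself.
-/

set_option autoImplicit false
set_option linter.dupNamespace false

noncomputable section

namespace Summit.HodgeConjecture.HodgeConjecture.Cruxes.H413.K2E1bDSCellUnitarizable

open Literature.RepresentationTheory.Kovacevic2021 Literature.RepresentationTheory.Kovacevic2021.SU21Datum
open Literature.RepresentationTheory.Kovacevic2021.SU21Datum.PrincipalSeries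
open Summit.HodgeConjecture.HodgeConjecture.Cruxes.H413.K2E1bGKCohomologyU21.U8 (IsRegularParam casimirOf centralOf)
open Summit.HodgeConjecture.HodgeConjecture.Cruxes.H413.K2E1bGKCohomologyU21.U8.LevelB
open Summit.HodgeConjecture.HodgeConjecture.Cruxes.H413.K2E1bDSCellData

-- Mathlib idiom (Mathlib/Algebra/Lie/OfAssociative.lean): commutator brackets on associative algebras; needed for the `𝔤𝔩(3,ℂ)`-module
-- structure on `𝒟.V`, exactly as in every ★ `Kovacevic2021` file and ★ `K2E1bDSCellData`.
attribute [local instance 100] LieRing.ofAssociativeRing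

/-! ## §1 Signs of Kovačević's `a(p)`, `b(q)` along the two series (from the ★ LEVEL-B factorisations) -/

/-- A complex number equal to the cast of a negative integer is a negative real. [folklore] -/
theorem im_eq_zero_and_re_neg_of_eq_intCast {z : ℂ} {k : ℤ} (h : z = (k : ℂ)) (hk : k < 0) : z.im = 0 ∧ z.re < 0 := by
  subst h
  exact ⟨Complex.intCast_im k, by rw [Complex.intCast_re]; exact_mod_cast hk⟩

section Regular

variable {a b c : ℤ}

/-- `a⁺(p) = −(p+a−b+1)(p+a−c+1)` is a NEGATIVE REAL on the whole cone (`a > b`, `a > c`, `p ≥ 0`). [cite: Kovacevic2021, §3 Thm 3 (b85), §4 Thm 4 (c30)] -/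
theorem acoef_plus_neg (hab : b < a) (hac : c < a) {p : ℤ} (hp : 0 ≤ p) :
    (acoef (cKPlus a b c) (tPlus a b c) p).im = 0 ∧ (acoef (cKPlus a b c) (tPlus a b c) p).re < 0 :=
  im_eq_zero_and_re_neg_of_eq_intCast (k := -((p + (a - b) + 1) * (p + (a - c) + 1)))
    (by rw [acoef_plus]; push_cast; ring) (neg_lt_zero.2 (mul_pos (by omega) (by omega)))

/-- `b⁺(q) = −(q−(a−b−1))(q−(a−c−1))` is a negative real BELOW the first root line (`q < a−b−1`, the `B`-edges of `D_φ⁺`; `a > c` makes the second factor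
negative too). [cite: Kovacevic2021, §3 Thm 3 (b90), §4 Thm 4 (c35)] -/
theorem bcoef_plus_neg_of_lt (hbc : c < b) {q : ℤ} (hq : q < a - b - 1) :
    (bcoef (cKPlus a b c) (tPlus a b c) q).im = 0 ∧ (bcoef (cKPlus a b c) (tPlus a b c) q).re < 0 :=
  im_eq_zero_and_re_neg_of_eq_intCast (k := -((q - (a - b - 1)) * (q - (a - c - 1))))
    (by rw [bcoef_plus]; push_cast; ring) (neg_lt_zero.2 (mul_pos_of_neg_of_neg (by omega) (by omega)))

/-- `b⁺(q)` is a negative real ABOVE the second root line (`q ≥ a−c`, the `B`-edges of `D_φ`; `c < b` puts the first root line below as well).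
[cite: Kovacevic2021, §3 Thm 3 (b90), §4 Thm 4 (c35)] -/
theorem bcoef_plus_neg_of_le (hbc : c < b) {q : ℤ} (hq : a - c ≤ q) :
    (bcoef (cKPlus a b c) (tPlus a b c) q).im = 0 ∧ (bcoef (cKPlus a b c) (tPlus a b c) q).re < 0 :=
  im_eq_zero_and_re_neg_of_eq_intCast (k := -((q - (a - b - 1)) * (q - (a - c - 1))))
    (by rw [bcoef_plus]; push_cast; ring) (neg_lt_zero.2 (mul_pos (by omega) (by omega)))

/-- `b⁻(q) = −(q+b−c+1)(q+a−c+1)` is a negative real on the whole cone (`b > c`, `a > c`, `q ≥ 0`). [cite: Kovacevic2021, §3 Thm 3 (b90), §4 Thm 4 (c35)] -/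
theorem bcoef_minus_neg (hbc : c < b) (hac : c < a) {q : ℤ} (hq : 0 ≤ q) :
    (bcoef (cKMinus a b c) (tMinus a b c) q).im = 0 ∧ (bcoef (cKMinus a b c) (tMinus a b c) q).re < 0 :=
  im_eq_zero_and_re_neg_of_eq_intCast (k := -((q + (b - c) + 1) * (q + (a - c) + 1)))
    (by rw [bcoef_minus]; push_cast; ring) (neg_lt_zero.2 (mul_pos (by omega) (by omega)))

/-- `a⁻(p) = −(p−(b−c−1))(p−(a−c−1))` is a negative real below the first root line (`p < b−c−1`, the `A`-edges of `D_φ⁻`; `a > b` makes the second factor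
negative too). [cite: Kovacevic2021, §3 Thm 3 (b85), §4 Thm 4 (c30)] -/
theorem acoef_minus_neg_of_lt (hab : b < a) {p : ℤ} (hp : p < b - c - 1) :
    (acoef (cKMinus a b c) (tMinus a b c) p).im = 0 ∧ (acoef (cKMinus a b c) (tMinus a b c) p).re < 0 :=
  im_eq_zero_and_re_neg_of_eq_intCast (k := -((p - (b - c - 1)) * (p - (a - c - 1))))
    (by rw [acoef_minus]; push_cast; ring) (neg_lt_zero.2 (mul_pos_of_neg_of_neg (by omega) (by omega)))

/-- A positive real multiple of a negative real is a negative real (in `ℂ`). [folklore] -/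
theorem im_eq_zero_and_re_neg_of_eq_ofReal_mul {r : ℝ} (hr : 0 < r) {w z : ℂ} (hz : z = (r : ℂ) * w) (hw : w.im = 0 ∧ w.re < 0) :
    z.im = 0 ∧ z.re < 0 := by
  subst hz
  rw [Complex.re_ofReal_mul, Complex.im_ofReal_mul, hw.1, mul_zero]
  exact ⟨rfl, mul_neg_of_pos_of_neg hr hw.2⟩

/-- **`A D′` on `V(c,2t)` inherits the sign of `a(p)`**: at the `K`-type `(p,q)` the invariant product is the positive real multiple `(p+1)∕(n(n+1))` of `a(p)`
(★ `principalSeries_AD`, (b75)); the `⇐` half of ★ `principalSeries_AD_sign`. [cite: Kovacevic2021, §3 Thm 3 (b75), §4 Thm 4 (c30)] -/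
theorem ps_AD_neg (c₀ : ℂ) (t : ℤ) {p q : ℤ} (hp : 0 ≤ p) (hq : 0 ≤ q) (ha : (acoef c₀ t p).im = 0 ∧ (acoef c₀ t p).re < 0) :
    ((principalSeries c₀ t).A (1 + p + q) (2 * t + 3 * p - 3 * q) * (principalSeries c₀ t).D (1 + p + q + 1) (2 * t + 3 * p - 3 * q + 3)).im = 0 ∧
      ((principalSeries c₀ t).A (1 + p + q) (2 * t + 3 * p - 3 * q) * (principalSeries c₀ t).D (1 + p + q + 1) (2 * t + 3 * p - 3 * q + 3)).re < 0 := by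
  refine im_eq_zero_and_re_neg_of_eq_ofReal_mul (r := ((p : ℝ) + 1) / ((1 + p + q) * (1 + p + q + 1))) ?_ ?_ ha
  · have : (0 : ℝ) ≤ p := by exact_mod_cast hp
    have : (0 : ℝ) ≤ q := by exact_mod_cast hq
    positivity
  · rw [principalSeries_AD c₀ t hp hq, acoef]
    push_cast
    ring

/-- **`B C′` on `V(c,2t)` inherits the sign of `b(q)`** (positive multiple `(q+1)∕(n(n+1))`, ★ `principalSeries_BC`, (b80)); the `⇐` half of ★ `principalSeries_BC_sign`.
[cite: Kovacevic2021, §3 Thm 3 (b80), §4 Thm 4 (c35)] -/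
theorem ps_BC_neg (c₀ : ℂ) (t : ℤ) {p q : ℤ} (hp : 0 ≤ p) (hq : 0 ≤ q) (hb : (bcoef c₀ t q).im = 0 ∧ (bcoef c₀ t q).re < 0) :
    ((principalSeries c₀ t).B (1 + p + q) (2 * t + 3 * p - 3 * q) * (principalSeries c₀ t).C (1 + p + q + 1) (2 * t + 3 * p - 3 * q - 3)).im = 0 ∧
      ((principalSeries c₀ t).B (1 + p + q) (2 * t + 3 * p - 3 * q) * (principalSeries c₀ t).C (1 + p + q + 1) (2 * t + 3 * p - 3 * q - 3)).re < 0 := by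
  refine im_eq_zero_and_re_neg_of_eq_ofReal_mul (r := ((q : ℝ) + 1) / ((1 + p + q) * (1 + p + q + 1))) ?_ ?_ hb
  · have : (0 : ℝ) ≤ p := by exact_mod_cast hp
    have : (0 : ℝ) ≤ q := by exact_mod_cast hq
    positivity
  · rw [principalSeries_BC c₀ t hp hq, bcoef]
    push_cast
    ring

/-! ## §2 Kovačević's Theorem 4 on the three cells -/

/-- **`D_φ`'s datum is unitarizable**: vertex = its Blattner vertex (a local minimum), every `A`-edge has `a⁺(p) < 0`, every `B`-edge (`q ≥ a−c`) has `b⁺(q) < 0`.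
[cite: Kovacevic2021, §4 Thm 4] [cite: BorelWallach2000, VI Thm 4.12] -/
theorem dsCellD_isUnitarizable (h : IsRegularParam a b c) : IsUnitarizable (dsCellD a b c) := by
  have hreg := h
  obtain ⟨h1, h2⟩ := h
  obtain ⟨hv, hvD, hvC, -⟩ := dsCellDatum_vertex_zero hreg
  have hS := fun n m => (mem_dsCellDatum_S_iff hreg n m).1
  refine (isUnitarizable_iff_products_neg (𝒟 := dsCellD a b c) (x₀ := ((a - c + 1, a + c - 2 * b) : ℤ × ℤ)) (dsCellD_reach hreg) hv hvD hvC
    (fun n m h₁ h₂ _ => dsCellDatum_square hreg 0 n m h₁ h₂)).2 ⟨?_, ?_⟩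
  · intro n m hx hy
    have hAD : (dsCellD a b c).A n m * (dsCellD a b c).D (n + 1) (m + 3) =
        (principalSeries (cKPlus a b c) (tPlus a b c)).A n m * (principalSeries (cKPlus a b c) (tPlus a b c)).D (n + 1) (m + 3) :=
      subquotient_AD hx
    obtain ⟨p, q, hp, hq, rfl, rfl, -⟩ := (hS _ _).1 hx
    rw [hAD]
    exact ps_AD_neg _ _ hp hq (acoef_plus_neg (by omega) (by omega) hp)
  · intro n m hx hy
    have hBC : (dsCellD a b c).B n m * (dsCellD a b c).C (n + 1) (m - 3) =
        (principalSeries (cKPlus a b c) (tPlus a b c)).B n m * (principalSeries (cKPlus a b c) (tPlus a b c)).C (n + 1) (m - 3) :=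
      subquotient_BC hx
    obtain ⟨p, q, hp, hq, rfl, rfl, hcq⟩ := (hS _ _).1 hx
    rw [hBC]
    exact ps_BC_neg _ _ hp hq (bcoef_plus_neg_of_le (by omega) hcq)

/-- **`D_φ⁺`'s datum is unitarizable**: vertex = the cone vertex `(1, 2t⁺)`, every `A`-edge has `a⁺(p) < 0`, every `B`-edge `(p,q) → (p,q+1)` inside the strip
(`q + 1 ≤ a−b−1`) has `b⁺(q) < 0`. [cite: Kovacevic2021, §4 Thm 4] [cite: BorelWallach2000, VI Thm 4.12] -/
theorem dsCellDplus_isUnitarizable (h : IsRegularParam a b c) : IsUnitarizable (dsCellDplus a b c) := by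
  have hreg := h
  obtain ⟨h1, h2⟩ := h
  obtain ⟨hv, hvD, hvC⟩ := dsCellDatum_coneVertex_one hreg
  have hS := fun n m => (mem_dsCellDatum_S_iff hreg n m).2.1
  refine (isUnitarizable_iff_products_neg (𝒟 := dsCellDplus a b c) (x₀ := ((1, 2 * tPlus a b c) : ℤ × ℤ)) (dsCellDplus_reach hreg) hv hvD hvC
    (fun n m h₁ h₂ _ => dsCellDatum_square hreg 1 n m h₁ h₂)).2 ⟨?_, ?_⟩
  · intro n m hx hy
    have hAD : (dsCellDplus a b c).A n m * (dsCellDplus a b c).D (n + 1) (m + 3) =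
        (principalSeries (cKPlus a b c) (tPlus a b c)).A n m * (principalSeries (cKPlus a b c) (tPlus a b c)).D (n + 1) (m + 3) :=
      subquotient_AD hx
    obtain ⟨p, q, hp, hq, rfl, rfl, -⟩ := (hS _ _).1 hx
    rw [hAD]
    exact ps_AD_neg _ _ hp hq (acoef_plus_neg (by omega) (by omega) hp)
  · intro n m hx hy
    have hBC : (dsCellDplus a b c).B n m * (dsCellDplus a b c).C (n + 1) (m - 3) =
        (principalSeries (cKPlus a b c) (tPlus a b c)).B n m * (principalSeries (cKPlus a b c) (tPlus a b c)).C (n + 1) (m - 3) :=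
      subquotient_BC hx
    obtain ⟨p, q, hp, hq, rfl, rfl, hcq⟩ := (hS _ _).1 hx
    obtain ⟨p', q', hp', hq', e', f', hcq'⟩ := (hS _ _).1 hy
    rw [hBC]
    exact ps_BC_neg _ _ hp hq (bcoef_plus_neg_of_lt (by omega) (by omega))

/-- **`D_φ⁻`'s datum is unitarizable**: vertex = the cone vertex `(1, 2t⁻)`, every `B`-edge has `b⁻(q) < 0`, every `A`-edge `(p,q) → (p+1,q)` inside the strip
(`p + 1 ≤ b−c−1`) has `a⁻(p) < 0`. [cite: Kovacevic2021, §4 Thm 4] [cite: BorelWallach2000, VI Thm 4.12] -/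
theorem dsCellDminus_isUnitarizable (h : IsRegularParam a b c) : IsUnitarizable (dsCellDminus a b c) := by
  have hreg := h
  obtain ⟨h1, h2⟩ := h
  obtain ⟨hv, hvD, hvC⟩ := dsCellDatum_coneVertex_two hreg
  have hS := fun n m => (mem_dsCellDatum_S_iff hreg n m).2.2
  refine (isUnitarizable_iff_products_neg (𝒟 := dsCellDminus a b c) (x₀ := ((1, 2 * tMinus a b c) : ℤ × ℤ)) (dsCellDminus_reach hreg) hv hvD hvC
    (fun n m h₁ h₂ _ => dsCellDatum_square hreg 2 n m h₁ h₂)).2 ⟨?_, ?_⟩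
  · intro n m hx hy
    have hAD : (dsCellDminus a b c).A n m * (dsCellDminus a b c).D (n + 1) (m + 3) =
        (principalSeries (cKMinus a b c) (tMinus a b c)).A n m * (principalSeries (cKMinus a b c) (tMinus a b c)).D (n + 1) (m + 3) :=
      subquotient_AD hx
    obtain ⟨p, q, hp, hq, rfl, rfl, hcp⟩ := (hS _ _).1 hx
    obtain ⟨p', q', hp', hq', e', f', hcp'⟩ := (hS _ _).1 hy
    rw [hAD]
    exact ps_AD_neg _ _ hp hq (acoef_minus_neg_of_lt (by omega) (by omega))
  · intro n m hx hy
    have hBC : (dsCellDminus a b c).B n m * (dsCellDminus a b c).C (n + 1) (m - 3) =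
        (principalSeries (cKMinus a b c) (tMinus a b c)).B n m * (principalSeries (cKMinus a b c) (tMinus a b c)).C (n + 1) (m - 3) :=
      subquotient_BC hx
    obtain ⟨p, q, hp, hq, rfl, rfl, -⟩ := (hS _ _).1 hx
    rw [hBC]
    exact ps_BC_neg _ _ hp hq (bcoef_minus_neg (by omega) (by omega) hq)

/-- **The three cell data of `Π(φ(a,b,c))` are UNITARIZABLE** (Kovačević's Theorem 4 on the product cells `D_φ`, `D_φ⁺`, `D_φ⁻`): the `IsUnitarizable` input of
★ #10 `K2E1bDatumCohUnitaryIrrep.DatumCohUnitaryIrrep` for the discrete-series carriers. [cite: Kovacevic2021, §4 Thm 4] [cite: BorelWallach2000, VI Thm 4.12]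
[cite: Rogawski1990, §12.3 p. 178] -/
theorem dsCellDatum_isUnitarizable (h : IsRegularParam a b c) (j : Fin 3) : IsUnitarizable (dsCellDatum j a b c) := by
  fin_cases j
  · exact dsCellD_isUnitarizable h
  · exact dsCellDplus_isUnitarizable h
  · exact dsCellDminus_isUnitarizable h

end Regular

end Summit.HodgeConjecture.HodgeConjecture.Cruxes.H413.K2E1bDSCellUnitarizable

end
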